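/-
Copyright (c) 2026 the pub-hodgecm-mathlib formalisation cell (harness21).  Prover seat hodgecm-mathlib-B-p04 (g48): LH4-plan (g6) WORD #124 «GO, STAGED», ENGINE′ layer (L1′)
= the EISENSTEIN twin of ★ [T2-c] abstract layer `QuadraticRamifiedOrderUnitIndex` (A-p19 p846518); 2026-09-02.
-/
import Literature.NumberTheory.Automorphic.QuadraticRamifiedOrderUnitIndex   -- ★ p846518 (A-p19): θ-free parts reused BY NAME: `index_range_units_map_mul_card_eq`, `coord_unique`, `natCard_quotient_span_of_coord`, `exists_ringEquiv_quotient_prod_span`, `natCard_quotient_prod_span`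
import HarnessLib

/-!
# The unit index of a local order in `Λ = 𝒪 × O₁`, `O₁ = 𝒪 ⊕ 𝒪θ`, `θ² = aθ + k` EISENSTEIN (`a, k ∈ 𝔪`): `[Λ^× : R^×] · q = (q − 1) · [Λ : R]`

Topic `NumberTheory/Automorphic`; namespace `Literature.NumberTheory.Automorphic`.  THEOREMS ONLY (no definition, no instance, no notation, no named fact, no `sorry`); generic
`[Field F] [ValuativeRel F]` = (D0) currency (`𝒪 = 𝒪[F]`, `𝓀 = 𝓀[F]`, `q = Nat.card 𝓀[F]`, `hϖ : IsUniformizingElement ϖ`) and an ABSTRACT commutative ring `O₁` with a ring map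
`j : 𝒪 →+* O₁` and an element `θ` such that every element of `O₁` is uniquely `j b + j c · θ` and **`θ² = j a · θ + j k` with `a, k ∈ 𝔪`** — the shape of the valuation ring of ANY
totally ramified quadratic extension presented on an EISENSTEIN uniformiser `θ` (root of `X² − aX − k`), in particular of the WILD unit-discriminant row `K = E_w(α)`, `α² = 1 + w₀`,
`θ = Π = (α − 1)∕ϖ^k`, `Π² = −(2∕ϖ^k)·Π + w₀∕ϖ^{2k}` (★ `WildQuadraticEisensteinFrame`), where NO uniformiser with square in `E_w` exists.  Cell `pub/hodgecm-mathlib` (D-0151), crux H413 =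
`stmt-HodgeConjecture-24833`; LH4-plan (g6) price list, B-p04 (g47) memo `MEMO-M4-wild-parity.v1` (4adf46b3) **§4 (c)-CONSUMER row «`TypeTwoUnitIndexAtPlace` at a wild unit row», level
`N′ = N + k − ord_v 2`** (census B-p04 (g48) `CENSUS-TypeTwoUnitIndexAtPlaceWild.v1` 959b1194): ENGINE′ = Eisenstein twins (L1′)(L2′)(L3′) of the ★ [T2-c] layers + head (H′); THIS FILE =
(L1′), the twin of ★ `QuadraticRamifiedOrderUnitIndex` §2–§3 (the ★ file is the case `a = 0`; it is UNTOUCHED and its θ-free lemmas — `coord_unique`, `natCard_quotient_span_of_coord`,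
`exists_ringEquiv_quotient_prod_span`, `natCard_quotient_prod_span`, §1 `index_range_units_map_mul_card_eq` — are cited BY NAME, not re-typed).
HONEST LABEL: HC_CM is proved only modulo the 7 printed citations (2 remaining named inputs: hLiu418 = stmt-HodgeConjecture-24832, h413 = stmt-HodgeConjecture-24833) until rung 0
closes; elementary ring theory, count-neutral (pays no organ, opens no road).

THE MATHEMATICS.  With `θ² = jaθ + jk`: `(jb + jcθ)(jb′ + jc′θ) = j(bb′ + cc′k) + j(bc′ + cb′ + cc′a)θ`; `jb + jcθ` is a unit iff `b` is (inverse from `(jb + jcθ)(j(b + ca) − jcθ) =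
j(b² + abc − c²k)`, a unit when `b` is since `a, k ∈ 𝔪`); the first coordinate read modulo `𝔪` is a surjective ring map `O₁ → 𝓀` killing exactly the non-units (the cross terms `cc′k`
die mod `𝔪`), so `O₁` is LOCAL with residue field `𝓀`; `#(O₁ ⧸ ϖ^m O₁) = q^{2m}` (★, θ-free) and `#(O₁ ⧸ ϖ^m O₁)^× = q^{2m−1}(q − 1)`; for `Λ = 𝒪 × O₁`: `#(Λ ⧸ ϖ^mΛ) = q^{3m}` (★),
`#(Λ ⧸ ϖ^mΛ)^× = (q−1)² q^{3m−2}`, `ϖ^mΛ ⊆ rad Λ`, hence for a local `R ≤ Λ` with residue field of size `q` and `ϖ^mΛ ⊆ R` (`m ≥ 1`): **`[Λ^× : R^×] · q = (q − 1) · [Λ : R]`**.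

* §2′ `coord_mul_eisenstein`, `isUnit_add_mul_iff_eisenstein`, `exists_residueHom_eisenstein`, `isLocalRing_of_coord_eisenstein`, `natCard_residueField_of_coord_eisenstein`,
  `natCard_units_quotient_span_of_coord_eisenstein`.
* §3′ `natCard_units_quotient_prod_span_eisenstein`, `prod_span_le_jacobson_eisenstein`, **`index_range_units_map_prod_mul_eq_eisenstein`**.

## References
* [Neukirch1999] J. Neukirch, *Algebraic Number Theory*, Grundlehren 322 (1999): Ch. I §12 (orders, conductor, `[𝒪_K^× : 𝒪^×]`, `#(𝒪_K⧸𝔣)^× ∕ #(𝒪⧸𝔣)^×`); Ch. II §5 (Eisenstein).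
* [SerreLocalFields1979] J.-P. Serre, *Local Fields*, GTM 67 (1979): Ch. I §6 Prop. 17–18 (totally ramified extensions, Eisenstein basis `𝒪_L = 𝒪_K ⊕ 𝒪_K π_L`).
* [Hungerford1974] T. W. Hungerford, *Algebra*, GTM 73 (1974): Ch. I Thm. 4.5 (index multiplicativity), Ch. III Thm. 2.9.
* [Rogawski1990] J. D. Rogawski, *Automorphic Representations of Unitary Groups in Three Variables* (1990): §4.9 Lemma 4.9.3 p. 56 (where the count is consumed).
-/

set_option autoImplicit false

noncomputable section

open scoped ValuativeRel

namespace Literature.NumberTheory.Automorphic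

open Literature.RingTheory.JacobsonRadical

/-! ## §2′ The ring `O₁ = j𝒪 ⊕ j𝒪·θ`, `θ² = jaθ + jk`, `a, k ∈ 𝔪` -/

section Coord

variable {F : Type*} [Field F] [ValuativeRel F] {O₁ : Type*} [CommRing O₁] (j : 𝒪[F] →+* O₁) (θ : O₁) {a k : 𝒪[F]}

/-- The EISENSTEIN multiplication table: `(jb + jcθ)(jb′ + jc′θ) = j(bb′ + cc′k) + j(bc′ + cb′ + cc′a)θ` (`θ² = jaθ + jk`). [cite: SerreLocalFields1979, Ch. I §6] -/
theorem coord_mul_eisenstein (hθ : θ ^ 2 = j a * θ + j k) (b c b' c' : 𝒪[F]) :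
    (j b + j c * θ) * (j b' + j c' * θ) = j (b * b' + c * c' * k) + j (b * c' + c * b' + c * c' * a) * θ := by
  have hθ2 : θ * θ = j a * θ + j k := by rw [← sq, hθ]
  simp only [map_add, map_mul]
  calc (j b + j c * θ) * (j b' + j c' * θ)
      = j b * j b' + (j c * j c') * (θ * θ) + (j b * j c' + j c * j b') * θ := by ring
    _ = j b * j b' + j c * j c' * (j a * θ + j k) + (j b * j c' + j c * j b') * θ := by rw [hθ2]
    _ = j b * j b' + j c * j c' * j k + (j b * j c' + j c * j b' + j c * j c' * j a) * θ := by ring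

/-- **`jb + jcθ` IS A UNIT IFF `b` IS** (`θ² = jaθ + jk`, `a, k ∈ 𝔪`): `(jb + jcθ)(j(b + ca) − jcθ) = j(b² + abc − c²k)` with `b² + abc − c²k ∈ 𝒪^×` when `b` is; conversely a relation
`(jb + jcθ)(jb′ + jc′θ) = 1` forces `bb′ + cc′k = 1`, impossible for `b ∈ 𝔪`. [cite: SerreLocalFields1979, Ch. I §6 Prop. 17–18] -/
theorem isUnit_add_mul_iff_eisenstein (hθ : θ ^ 2 = j a * θ + j k) (ha : a ∈ IsLocalRing.maximalIdeal 𝒪[F]) (hk : k ∈ IsLocalRing.maximalIdeal 𝒪[F])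
    (hcoord : ∀ z : O₁, ∃! bc : 𝒪[F] × 𝒪[F], z = j bc.1 + j bc.2 * θ) (b c : 𝒪[F]) : IsUnit (j b + j c * θ) ↔ IsUnit b := by
  constructor
  · rintro ⟨u, hu⟩
    obtain ⟨⟨b', c'⟩, hz, -⟩ := hcoord (↑u⁻¹ : O₁)
    have hprod : (j b + j c * θ) * (j b' + j c' * θ) = j 1 + j 0 * θ := by
      rw [← hu, ← hz, Units.mul_inv, map_one, map_zero, zero_mul, add_zero]
    rw [coord_mul_eisenstein j θ hθ] at hprod
    have h1 := (coord_unique j θ hcoord hprod).1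
    by_contra hb
    have hbm : b ∈ IsLocalRing.maximalIdeal 𝒪[F] := (IsLocalRing.mem_maximalIdeal _).2 hb
    have hmem : b * b' + c * c' * k ∈ IsLocalRing.maximalIdeal 𝒪[F] :=
      Ideal.add_mem _ (Ideal.mul_mem_right _ _ hbm) (Ideal.mul_mem_left _ _ hk)
    rw [h1] at hmem
    exact (IsLocalRing.maximalIdeal.isMaximal 𝒪[F]).ne_top (Ideal.eq_top_of_isUnit_mem _ hmem isUnit_one)
  · intro hb
    have hnu : IsUnit (b * b + a * b * c - c * c * k) := by
      have hm : c * c * k ∈ IsLocalRing.maximalIdeal 𝒪[F] := Ideal.mul_mem_left _ _ hk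
      have hm' : a * b * c ∈ IsLocalRing.maximalIdeal 𝒪[F] := Ideal.mul_mem_right _ _ (Ideal.mul_mem_right _ _ ha)
      by_contra hn
      have hn' : b * b + a * b * c - c * c * k ∈ IsLocalRing.maximalIdeal 𝒪[F] := (IsLocalRing.mem_maximalIdeal _).2 hn
      have : b * b ∈ IsLocalRing.maximalIdeal 𝒪[F] := by
        have := Ideal.sub_mem _ (Ideal.add_mem _ hn' hm) hm'
        rwa [sub_add_cancel, add_sub_cancel_right] at this
      rcases (IsLocalRing.maximalIdeal.isMaximal 𝒪[F]).isPrime.mem_or_mem this with h | h <;>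
        exact ((IsLocalRing.mem_maximalIdeal _).1 h) hb
    obtain ⟨w, hw⟩ := hnu
    refine IsUnit.of_mul_eq_one ((j (b + c * a) + j (-c) * θ) * j (↑w⁻¹ : 𝒪[F])) ?_
    rw [← mul_assoc, coord_mul_eisenstein j θ hθ]
    have e1 : b * (b + c * a) + c * -c * k = b * b + a * b * c - c * c * k := by ring
    have e2 : b * -c + c * (b + c * a) + c * -c * a = 0 := by ring
    rw [e1, e2, map_zero, zero_mul, add_zero, ← map_mul, ← hw, Units.mul_inv, map_one]

/-- **THE RESIDUE MAP `jb + jcθ ↦ b̄`** is a surjective ring homomorphism `O₁ → 𝓀` whose kernel is exactly the set of non-units (`k ∈ 𝔪` kills the `cc′k` cross term of the first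
coordinate; the `a`-term lives in the second coordinate only). [cite: SerreLocalFields1979, Ch. I §6 Prop. 17] -/
theorem exists_residueHom_eisenstein (hθ : θ ^ 2 = j a * θ + j k) (ha : a ∈ IsLocalRing.maximalIdeal 𝒪[F]) (hk : k ∈ IsLocalRing.maximalIdeal 𝒪[F])
    (hcoord : ∀ z : O₁, ∃! bc : 𝒪[F] × 𝒪[F], z = j bc.1 + j bc.2 * θ) :
    ∃ ρ : O₁ →+* 𝓀[F], Function.Surjective ρ ∧ (∀ b c : 𝒪[F], ρ (j b + j c * θ) = IsLocalRing.residue 𝒪[F] b) ∧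
    ∀ z : O₁, ρ z = 0 ↔ ¬ IsUnit z := by
  classical
  -- coordinate functions
  set B : O₁ → 𝒪[F] := fun z => (hcoord z).choose.1 with hB
  set C : O₁ → 𝒪[F] := fun z => (hcoord z).choose.2 with hC
  have hBC : ∀ z, z = j (B z) + j (C z) * θ := fun z => (hcoord z).choose_spec.1
  have hBC' : ∀ b c, B (j b + j c * θ) = b ∧ C (j b + j c * θ) = c := by
    intro b c
    have h := hBC (j b + j c * θ)
    have := coord_unique j θ hcoord h
    exact ⟨this.1.symm, this.2.symm⟩
  have hB1 : B 1 = 1 := by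
    have h := (hBC' 1 0).1
    rwa [map_one, map_zero, zero_mul, add_zero] at h
  have hB0 : B 0 = 0 := by
    have h := (hBC' 0 0).1
    rwa [map_zero, zero_mul, add_zero] at h
  have hBadd : ∀ z z', B (z + z') = B z + B z' := by
    intro z z'
    have hsum : z + z' = j (B z + B z') + j (C z + C z') * θ := by
      conv_lhs => rw [hBC z, hBC z']
      simp only [map_add]; ring
    rw [hsum, (hBC' _ _).1]
  have hk0 : IsLocalRing.residue 𝒪[F] k = 0 := (IsLocalRing.residue_eq_zero_iff _).2 hk
  have hBmul : ∀ z z', IsLocalRing.residue 𝒪[F] (B (z * z')) = IsLocalRing.residue 𝒪[F] (B z) * IsLocalRing.residue 𝒪[F] (B z') := by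
    intro z z'
    have hprod : z * z' = j (B z * B z' + C z * C z' * k) + j (B z * C z' + C z * B z' + C z * C z' * a) * θ := by
      conv_lhs => rw [hBC z, hBC z']
      rw [coord_mul_eisenstein j θ hθ]
    rw [hprod, (hBC' _ _).1, map_add, map_mul, map_mul, map_mul, hk0, mul_zero, add_zero]
  let ρ : O₁ →+* 𝓀[F] :=
    { toFun := fun z => IsLocalRing.residue 𝒪[F] (B z)
      map_one' := by show IsLocalRing.residue 𝒪[F] (B 1) = 1; rw [hB1, map_one]
      map_mul' := fun z z' => by
        show IsLocalRing.residue 𝒪[F] (B (z * z')) = IsLocalRing.residue 𝒪[F] (B z) * IsLocalRing.residue 𝒪[F] (B z')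
        exact hBmul z z'
      map_zero' := by show IsLocalRing.residue 𝒪[F] (B 0) = 0; rw [hB0, map_zero]
      map_add' := fun z z' => by
        show IsLocalRing.residue 𝒪[F] (B (z + z')) = IsLocalRing.residue 𝒪[F] (B z) + IsLocalRing.residue 𝒪[F] (B z')
        rw [hBadd, map_add] }
  have hρ : ∀ z, ρ z = IsLocalRing.residue 𝒪[F] (B z) := fun _ => rfl
  refine ⟨ρ, fun x => ?_, fun b c => ?_, fun z => ?_⟩
  · obtain ⟨b, rfl⟩ := IsLocalRing.residue_surjective x
    exact ⟨j b + j 0 * θ, by rw [hρ, (hBC' b 0).1]⟩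
  · rw [hρ, (hBC' b c).1]
  · rw [hρ, IsLocalRing.residue_eq_zero_iff, IsLocalRing.mem_maximalIdeal, mem_nonunits_iff]
    conv_rhs => rw [hBC z]
    rw [isUnit_add_mul_iff_eisenstein j θ hθ ha hk hcoord]

/-- **`O₁` IS LOCAL** (its non-units form the kernel of the residue map). [cite: SerreLocalFields1979, Ch. I §6 Prop. 17] -/
theorem isLocalRing_of_coord_eisenstein (hθ : θ ^ 2 = j a * θ + j k) (ha : a ∈ IsLocalRing.maximalIdeal 𝒪[F]) (hk : k ∈ IsLocalRing.maximalIdeal 𝒪[F])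
    (hcoord : ∀ z : O₁, ∃! bc : 𝒪[F] × 𝒪[F], z = j bc.1 + j bc.2 * θ) :
    IsLocalRing O₁ := by
  obtain ⟨ρ, -, -, hker⟩ := exists_residueHom_eisenstein j θ hθ ha hk hcoord
  haveI : Nontrivial O₁ := by
    refine ⟨⟨0, 1, fun h => ?_⟩⟩
    have h1 : ¬ IsUnit (1 : O₁) := (hker 1).1 (by rw [← h, map_zero])
    exact h1 isUnit_one
  refine IsLocalRing.of_nonunits_add ?_
  intro x y hx hy
  rw [mem_nonunits_iff] at hx hy ⊢
  rw [← hker] at hx hy ⊢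
  rw [map_add, hx, hy, add_zero]

/-- **THE RESIDUE FIELD OF `O₁` IS `𝓀`**: `#k_{O₁} = q` (`O₁ ⧸ 𝔪 ≅ 𝓀` through the residue map). [cite: SerreLocalFields1979, Ch. I §6 Prop. 17] -/
theorem natCard_residueField_of_coord_eisenstein [Finite 𝓀[F]] (hθ : θ ^ 2 = j a * θ + j k) (ha : a ∈ IsLocalRing.maximalIdeal 𝒪[F]) (hk : k ∈ IsLocalRing.maximalIdeal 𝒪[F])
    (hcoord : ∀ z : O₁, ∃! bc : 𝒪[F] × 𝒪[F], z = j bc.1 + j bc.2 * θ) :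
    @Nat.card (@IsLocalRing.ResidueField O₁ _ (isLocalRing_of_coord_eisenstein j θ hθ ha hk hcoord)) = Nat.card 𝓀[F] := by
  letI := isLocalRing_of_coord_eisenstein j θ hθ ha hk hcoord
  obtain ⟨ρ, hsurj, -, hker⟩ := exists_residueHom_eisenstein j θ hθ ha hk hcoord
  have hkerEq : RingHom.ker ρ = IsLocalRing.maximalIdeal O₁ := by
    ext z
    rw [RingHom.mem_ker, hker, IsLocalRing.mem_maximalIdeal, mem_nonunits_iff]
  unfold IsLocalRing.ResidueField
  rw [← hkerEq]
  exact Nat.card_congr (RingHom.quotientKerEquivOfSurjective hsurj).toEquiv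

/-- **`#(O₁ ⧸ ϖ^m O₁)^× = q^{2m−1}(q − 1)`** for `m ≥ 1` (finite local ring with residue field `𝓀`: ★ `natCard_units_mul_natCard_residueField`; `#(O₁ ⧸ ϖ^m O₁) = q^{2m}` is ★
`natCard_quotient_span_of_coord`, θ-free). [cite: Neukirch1999, Ch. I §12] [cite: SerreLocalFields1979, Ch. I §6 Prop. 18] -/
theorem natCard_units_quotient_span_of_coord_eisenstein [Finite 𝓀[F]] (hθ : θ ^ 2 = j a * θ + j k) (ha : a ∈ IsLocalRing.maximalIdeal 𝒪[F]) (hk : k ∈ IsLocalRing.maximalIdeal 𝒪[F])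
    (hcoord : ∀ z : O₁, ∃! bc : 𝒪[F] × 𝒪[F], z = j bc.1 + j bc.2 * θ) {ϖ : F} (hϖ : IsUniformizingElement ϖ) {m : ℕ} (hm : 0 < m) :
    Nat.card (O₁ ⧸ Ideal.span ({j ((⟨ϖ, hϖ.mem⟩ : 𝒪[F]) ^ m)} : Set O₁))ˣ = Nat.card 𝓀[F] ^ (2 * m - 1) * (Nat.card 𝓀[F] - 1) := by
  classical
  letI := isLocalRing_of_coord_eisenstein j θ hθ ha hk hcoord
  set π : 𝒪[F] := ⟨ϖ, hϖ.mem⟩ with hπ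
  set J : Ideal O₁ := Ideal.span ({j (π ^ m)} : Set O₁) with hJ
  have hq : 1 < Nat.card 𝓀[F] := Finite.one_lt_card
  have hcard : Nat.card (O₁ ⧸ J) = Nat.card 𝓀[F] ^ (2 * m) := natCard_quotient_span_of_coord j θ hcoord hϖ m
  haveI : Finite (O₁ ⧸ J) := Nat.finite_of_card_ne_zero (by rw [hcard]; exact pow_ne_zero _ (by omega))
  have hπmax : π ∈ IsLocalRing.maximalIdeal 𝒪[F] := by
    rw [← hϖ.span_coe_eq_maximalIdeal]; exact Ideal.mem_span_singleton_self _
  have hJtop : J ≠ ⊤ := by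
    intro h
    have h1 : (1 : O₁) ∈ J := h ▸ Submodule.mem_top
    rw [hJ, Ideal.mem_span_singleton'] at h1
    obtain ⟨x, hx⟩ := h1
    have hu : IsUnit (j (π ^ m)) := IsUnit.of_mul_eq_one_right x hx
    have hu' : IsUnit (j (π ^ m) + j 0 * θ) := by rwa [map_zero, zero_mul, add_zero]
    rw [isUnit_add_mul_iff_eisenstein j θ hθ ha hk hcoord] at hu'
    exact (IsLocalRing.mem_maximalIdeal _ |>.1 (Ideal.pow_mem_of_mem _ hπmax _ hm)) hu'
  haveI : Nontrivial (O₁ ⧸ J) := Ideal.Quotient.nontrivial_iff.2 hJtop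
  haveI : IsLocalRing (O₁ ⧸ J) := IsLocalRing.of_surjective' (Ideal.Quotient.mk J) Ideal.Quotient.mk_surjective
  have hres : Nat.card (IsLocalRing.ResidueField (O₁ ⧸ J)) = Nat.card 𝓀[F] := by
    rw [natCard_residueField_quotient_eq J]
    exact natCard_residueField_of_coord_eisenstein j θ hθ ha hk hcoord
  have key := natCard_units_mul_natCard_residueField (Λ := O₁ ⧸ J)
  rw [hres, hcard] at key
  obtain ⟨m', rfl⟩ := Nat.exists_eq_add_of_le hm
  have : Nat.card (O₁ ⧸ J)ˣ * Nat.card 𝓀[F] = (Nat.card 𝓀[F] ^ (2 * (1 + m') - 1) * (Nat.card 𝓀[F] - 1)) * Nat.card 𝓀[F] := by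
    rw [key]
    have e : 2 * (1 + m') = (2 * (1 + m') - 1) + 1 := by omega
    conv_lhs => rw [e, pow_succ]
    ring
  exact Nat.eq_of_mul_eq_mul_right (by omega) this

end Coord

/-! ## §3′ `Λ = 𝒪 × O₁`: the conductor ideal `ϖ^m Λ`, its units, and the unit index of a local order -/

section Prod

variable {F : Type*} [Field F] [ValuativeRel F] {O₁ : Type*} [CommRing O₁] (j : 𝒪[F] →+* O₁) (θ : O₁) {a k : 𝒪[F]}

/-- **`#(Λ ⧸ ϖ^m Λ)^× = (q^{m−1}(q−1)) · (q^{2m−1}(q−1))`** for `Λ = 𝒪 × O₁`, `m ≥ 1` (★ `exists_ringEquiv_quotient_prod_span`, θ-free, and §2′).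
[cite: Neukirch1999, Ch. I §12] [cite: SerreLocalFields1979, Ch. I §6 Prop. 18] -/
theorem natCard_units_quotient_prod_span_eisenstein [Finite 𝓀[F]] (hθ : θ ^ 2 = j a * θ + j k) (ha : a ∈ IsLocalRing.maximalIdeal 𝒪[F]) (hk : k ∈ IsLocalRing.maximalIdeal 𝒪[F])
    (hcoord : ∀ z : O₁, ∃! bc : 𝒪[F] × 𝒪[F], z = j bc.1 + j bc.2 * θ) {ϖ : F} (hϖ : IsUniformizingElement ϖ) {m : ℕ} (hm : 0 < m) :
    Nat.card ((𝒪[F] × O₁) ⧸ Ideal.span ({(((⟨ϖ, hϖ.mem⟩ : 𝒪[F]) ^ m, j ((⟨ϖ, hϖ.mem⟩ : 𝒪[F]) ^ m)) : 𝒪[F] × O₁)} : Set (𝒪[F] × O₁)))ˣ =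
      (Nat.card 𝓀[F] ^ (m - 1) * (Nat.card 𝓀[F] - 1)) * (Nat.card 𝓀[F] ^ (2 * m - 1) * (Nat.card 𝓀[F] - 1)) := by
  obtain ⟨e⟩ := exists_ringEquiv_quotient_prod_span j ((⟨ϖ, hϖ.mem⟩ : 𝒪[F]) ^ m)
  rw [Nat.card_congr (Units.mapEquiv e.toMulEquiv).toEquiv, Nat.card_congr (MulEquiv.prodUnits).toEquiv, Nat.card_prod,
    natCard_units_quotient_span_uniformizer_pow hϖ hm, natCard_units_quotient_span_of_coord_eisenstein j θ hθ ha hk hcoord hϖ hm]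

/-- `ϖ^m Λ ⊆ rad Λ` for `m ≥ 1` (`Λ = 𝒪 × O₁`; componentwise `1 + ϖ^m(…)` is a unit: in `𝒪` as `𝒪` is local, in `O₁` by the Eisenstein unit criterion). [cite: Neukirch1999, Ch. I §12] -/
theorem prod_span_le_jacobson_eisenstein (hθ : θ ^ 2 = j a * θ + j k) (ha : a ∈ IsLocalRing.maximalIdeal 𝒪[F]) (hk : k ∈ IsLocalRing.maximalIdeal 𝒪[F])
    (hcoord : ∀ z : O₁, ∃! bc : 𝒪[F] × 𝒪[F], z = j bc.1 + j bc.2 * θ) {ϖ : F} (hϖ : IsUniformizingElement ϖ) {m : ℕ} (hm : 0 < m) :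
    Ideal.span ({(((⟨ϖ, hϖ.mem⟩ : 𝒪[F]) ^ m, j ((⟨ϖ, hϖ.mem⟩ : 𝒪[F]) ^ m)) : 𝒪[F] × O₁)} : Set (𝒪[F] × O₁)) ≤ Ideal.jacobson ⊥ := by
  classical
  letI := isLocalRing_of_coord_eisenstein j θ hθ ha hk hcoord
  set π : 𝒪[F] := ⟨ϖ, hϖ.mem⟩ with hπ
  have hπmax : π ∈ IsLocalRing.maximalIdeal 𝒪[F] := by
    rw [← hϖ.span_coe_eq_maximalIdeal]; exact Ideal.mem_span_singleton_self _
  have hπm : π ^ m ∈ IsLocalRing.maximalIdeal 𝒪[F] := Ideal.pow_mem_of_mem _ hπmax _ hm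
  -- `j (π^m)` is a non-unit of the local ring `O₁`
  have hjm : j (π ^ m) ∈ IsLocalRing.maximalIdeal O₁ := by
    rw [IsLocalRing.mem_maximalIdeal, mem_nonunits_iff]
    have : ¬ IsUnit (j (π ^ m) + j 0 * θ) := by
      rw [isUnit_add_mul_iff_eisenstein j θ hθ ha hk hcoord]; exact (IsLocalRing.mem_maximalIdeal _).1 hπm
    rwa [map_zero, zero_mul, add_zero] at this
  rw [Ideal.span_le]
  intro x hx
  rw [Set.mem_singleton_iff] at hx
  subst hx
  rw [SetLike.mem_coe, Ideal.mem_jacobson_bot]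
  rintro ⟨y₁, y₂⟩
  rw [Prod.mk_mul_mk, Prod.mk_add_mk, Prod.isUnit_iff]
  constructor
  · have h1 : π ^ m * y₁ ∈ IsLocalRing.maximalIdeal 𝒪[F] := Ideal.mul_mem_right _ _ hπm
    rw [← IsLocalRing.jacobson_eq_maximalIdeal ⊥ bot_ne_top, Ideal.mem_jacobson_bot] at h1
    simpa using h1 1
  · have h2 : j (π ^ m) * y₂ ∈ IsLocalRing.maximalIdeal O₁ := Ideal.mul_mem_right _ _ hjm
    rw [← IsLocalRing.jacobson_eq_maximalIdeal ⊥ bot_ne_top, Ideal.mem_jacobson_bot] at h2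
    simpa using h2 1

/-- **THE UNIT INDEX OF A LOCAL ORDER IN `𝒪 × 𝒪[θ]`, `θ` EISENSTEIN.**  `Λ = 𝒪 × O₁` (`O₁ = j𝒪 ⊕ j𝒪θ`, `θ² = jaθ + jk`, `a, k ∈ 𝔪`; `𝒪` a DVR with residue field of size `q`),
`R ≤ Λ` a LOCAL subring whose residue field has `q` elements and which contains `ϖ^m Λ` for some `m ≥ 1`.  Then **`[Λ^× : R^×] · q = (q − 1) · [Λ : R]`** (`R^×` =
`(Units.map R.subtype).range`): ★ §1 `index_range_units_map_mul_card_eq` with `#(Λ⧸ϖ^mΛ) = q^{3m}` (★), `#(Λ⧸ϖ^mΛ)^× = (q−1)² q^{3m−2}` and cancellation of `(q−1) q^{3m−1}`.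
(Eisenstein twin of ★ `index_range_units_map_prod_mul_eq`, the case `a = 0`.) [cite: Neukirch1999, Ch. I §12] [cite: Rogawski1990, §4.9 Lemma 4.9.3 p. 56] -/
theorem index_range_units_map_prod_mul_eq_eisenstein [Finite 𝓀[F]] (hθ : θ ^ 2 = j a * θ + j k) (ha : a ∈ IsLocalRing.maximalIdeal 𝒪[F]) (hk : k ∈ IsLocalRing.maximalIdeal 𝒪[F])
    (hcoord : ∀ z : O₁, ∃! bc : 𝒪[F] × 𝒪[F], z = j bc.1 + j bc.2 * θ) {ϖ : F} (hϖ : IsUniformizingElement ϖ) {m : ℕ} (hm : 0 < m)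
    (R : Subring (𝒪[F] × O₁)) [IsLocalRing R] (hres : Nat.card (IsLocalRing.ResidueField R) = Nat.card 𝓀[F])
    (hcond : ∀ x : 𝒪[F] × O₁, (((⟨ϖ, hϖ.mem⟩ : 𝒪[F]) ^ m, j ((⟨ϖ, hϖ.mem⟩ : 𝒪[F]) ^ m)) : 𝒪[F] × O₁) * x ∈ R) :
    (Units.map (R.subtype : R →* 𝒪[F] × O₁)).range.index * Nat.card 𝓀[F] = (Nat.card 𝓀[F] - 1) * R.toAddSubgroup.index := by
  classical
  set π : 𝒪[F] := ⟨ϖ, hϖ.mem⟩ with hπ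
  set 𝔣 : Ideal (𝒪[F] × O₁) := Ideal.span ({((π ^ m, j (π ^ m)) : 𝒪[F] × O₁)} : Set (𝒪[F] × O₁)) with h𝔣
  have hq : 1 < Nat.card 𝓀[F] := Finite.one_lt_card
  have h𝔣R : (𝔣 : Set (𝒪[F] × O₁)) ⊆ R := by
    intro x hx
    rw [SetLike.mem_coe, h𝔣, Ideal.mem_span_singleton'] at hx
    obtain ⟨y, rfl⟩ := hx
    rw [mul_comm]; exact hcond y
  have h𝔣J : 𝔣 ≤ Ideal.jacobson ⊥ := prod_span_le_jacobson_eisenstein j θ hθ ha hk hcoord hϖ hm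
  have hcard : Nat.card ((𝒪[F] × O₁) ⧸ 𝔣) = Nat.card 𝓀[F] ^ (3 * m) := natCard_quotient_prod_span j θ hcoord hϖ m
  have hunits : Nat.card ((𝒪[F] × O₁) ⧸ 𝔣)ˣ = (Nat.card 𝓀[F] ^ (m - 1) * (Nat.card 𝓀[F] - 1)) * (Nat.card 𝓀[F] ^ (2 * m - 1) * (Nat.card 𝓀[F] - 1)) :=
    natCard_units_quotient_prod_span_eisenstein j θ hθ ha hk hcoord hϖ hm
  haveI : Finite ((𝒪[F] × O₁) ⧸ 𝔣) := Nat.finite_of_card_ne_zero (by rw [hcard]; exact pow_ne_zero _ (by omega))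
  have hπmax : π ∈ IsLocalRing.maximalIdeal 𝒪[F] := by
    rw [← hϖ.span_coe_eq_maximalIdeal]; exact Ideal.mem_span_singleton_self _
  have h𝔣top : Ideal.comap R.subtype 𝔣 ≠ ⊤ := by
    intro htop
    have h1 : (1 : R) ∈ Ideal.comap R.subtype 𝔣 := htop ▸ Submodule.mem_top
    rw [Ideal.mem_comap, map_one, h𝔣, Ideal.mem_span_singleton'] at h1
    obtain ⟨⟨x, y⟩, hxy⟩ := h1
    rw [Prod.mk_mul_mk, Prod.mk_eq_one] at hxy
    have hu : IsUnit (π ^ m) := IsUnit.of_mul_eq_one_right x hxy.1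
    exact (IsLocalRing.mem_maximalIdeal _ |>.1 (Ideal.pow_mem_of_mem _ hπmax _ hm)) hu
  have key := index_range_units_map_mul_card_eq R 𝔣 h𝔣R h𝔣J h𝔣top
  rw [hres, hcard, hunits] at key
  -- cancel `(q - 1) q^{3m-1}`
  obtain ⟨m', rfl⟩ := Nat.exists_eq_add_of_le hm
  obtain ⟨p, hp⟩ : ∃ p, Nat.card 𝓀[F] = p + 1 := ⟨Nat.card 𝓀[F] - 1, by omega⟩
  set U := (Units.map (R.subtype : R →* 𝒪[F] × O₁)).range.index
  set I := R.toAddSubgroup.index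
  rw [hp] at key ⊢
  simp only [Nat.add_sub_cancel, Nat.add_sub_cancel_left] at key ⊢
  have e1 : 2 * (1 + m') - 1 = 2 * m' + 1 := by omega
  rw [e1] at key
  have hp0 : 0 < p := by omega
  have hpos : 0 < p * (p + 1) ^ (3 * m' + 2) := Nat.mul_pos hp0 (pow_pos (Nat.succ_pos p) _)
  refine Nat.eq_of_mul_eq_mul_right hpos ?_
  have lhs : U * (p + 1) * (p * (p + 1) ^ (3 * m' + 2)) = U * (p + 1) ^ (3 * (1 + m')) * p := by ring
  rw [lhs, key]
  ring

end Prod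

end Literature.NumberTheory.Automorphic

end
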